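import Literature.NumberTheory.LFunctions.BondarenkoHeap2026Prop1ExplicitSides
import HarnessLib

/-!
# Bondarenko–Heap 2026, Proposition 1 — module (M4): the bookkeeping and `proposition1_holds`

LABEL (cell `rh-crit`, corpus C5 `ah`): **NOT RH-BEARING.** `proposition1` keeps
`RiemannHypothesis →` as its antecedent exactly as printed ("Assume RH."); this module is the
bookkeeping that turns the explicit formula for the one test function `B_{T,h}` into the
inequality of [BondarenkoHeap2026, §2.2, Proposition 1, p. 6–7, TeX l.313–341]. Nothing here bears
on the truth of RH.

The last module of the `proposition1_holds` programme (lead rulings R-g5-8/R-g5-16; modules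
(M1) `BondarenkoHeap2026Prop1TestFunction` — `B_{T,h}` and `Prop1.explicit_formula_BC`;
(M2) `BondarenkoHeap2026Prop1ExplicitSides` — zero side `Prop1.tsum_zeroSide_BC_eq`, prime side
`Prop1.primeSide_BC_eq_primeSum`, `Prop1.fourier_BC_zero_eq_gapWidth_mul_I0R`;
(M3) `BondarenkoHeap2026Prop1Archimedean` — `Arch.exists_abs_archimedean_bWindow_sub_le`):

* `Prop1.archimedean_bookkeeping` — the real bookkeeping of TeX l.313–325 ("by the decay of `W_T`
  we may restrict the `t` integral to `T^{1−ε} ≤ |t| ≤ T^{1+ε}` … `h log|t| + o(1) =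
  2πc(1 + O₁(ε)) + o(1)` … "extend the `t` integral to `ℝ` at the cost of a negligible error"):
  with `h = 2πc/log T`, for `B ≥ B₀(ε, C, C_L)` and `T ≥ T₀`,
  `|(h/2π)∫_{|t|≥4}|R|²W_T log(|t|/2) − (h log π/2π) I₀ − c I₀| ≤ ε I₀ + (η/2) I₀ + (K/2)T^{−C}`,
  together with the polar budget (`Prop1.norm_BC_polar_le` `≪ L^{1+ε}T^{−2B} ≤ (K/4)T^{−C}`) and
  the Archimedean-constant budget `(C₃/2π) h I₀ ≤ (η/2) I₀`; inner range by
  `Extension.weight_le_of_abs_le`, tail by `Extension.exists_weight_tail_bound`, resonator size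
  `Σ_{n≤L}|r(n)| ≤ A L^{1+ε}` (`Prop1.sum_abs_le`);
* `Prop1.proposition1_of_sides` — Proposition 1 from the four side identities/bounds as hypotheses
  (the shapes of (M2), (M3)), via `Prop1.explicit_formula_BC`;
* `proposition1_holds : proposition1` — (M2) and (M3) plugged in by name.

No named facts; no new definitions.

## References

* [BondarenkoHeap2026] A. Bondarenko, W. Heap, arXiv:2608.07399v1, §2.2 Proposition 1 and its proof,
  p. 6–7 (TeX l.283–341). [cite: BondarenkoHeap2026, §2.2 Proposition 1]
* [BalazardDeRoton2008] M. Balazard, A. de Roton, arXiv:0810.3587, Prop. 11 (the explicit formula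
  used, `ExplicitFormulaBandLimited.lean`).
-/

noncomputable section

open Real MeasureTheory Set Filter Complex
open scoped FourierTransform

namespace Literature.NumberTheory.LFunctions

namespace BondarenkoHeap2026

namespace Prop1

/-- `Σ_{n ≤ L} |r(n)| ≤ A L^{1+ε}` for a resonator with `|r(n)| ≤ A n^ε`.
[cite: BondarenkoHeap2026, §2.2 p. 6 (polar terms, `L^{1+ε}`)] -/
theorem sum_abs_le {r : ℕ → ℝ} {A ε L : ℝ} (hA : 0 ≤ A) (hε : 0 ≤ ε) (hL : 1 ≤ L)
    (hr : ∀ n : ℕ, 1 ≤ n → |r n| ≤ A * (n : ℝ) ^ ε) :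
    ∑ n ∈ Finset.Icc 1 ⌊L⌋₊, |r n| ≤ A * L ^ (1 + ε) := by
  have hL0 : 0 < L := by linarith
  calc ∑ n ∈ Finset.Icc 1 ⌊L⌋₊, |r n| ≤ ∑ n ∈ Finset.Icc 1 ⌊L⌋₊, A * L ^ ε := by
        refine Finset.sum_le_sum fun n hn ↦ ?_
        have hn1 : 1 ≤ n := (Finset.mem_Icc.mp hn).1
        have hnL : (n : ℝ) ≤ L :=
          le_trans (by exact_mod_cast (Finset.mem_Icc.mp hn).2) (Nat.floor_le hL0.le)
        exact (hr n hn1).trans (mul_le_mul_of_nonneg_left (Real.rpow_le_rpow (by positivity) hnL hε) hA)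
    _ = ⌊L⌋₊ * (A * L ^ ε) := by
        rw [Finset.sum_const, Nat.card_Icc, nsmul_eq_mul]; simp
    _ ≤ L * (A * L ^ ε) := mul_le_mul_of_nonneg_right (Nat.floor_le hL0.le) (by positivity)
    _ = A * L ^ (1 + ε) := by rw [Real.rpow_add hL0, Real.rpow_one]; ring

/-- Inner range: `W_T(t) ≤ 2^B T^{−2εB} · 2C_Φ²` for `|t| ≤ T^{1−ε}` (`T ≥ 1`, `ε < 1`,
`|Φ| ≤ C_Φ`). [cite: BondarenkoHeap2026, §2.2 p. 6 ("by the decay of W_T")] -/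
theorem weight_le_inner (w : Bump) (B : ℕ) {T ε CΦ : ℝ} (hT : 1 ≤ T) (hε1 : ε < 1)
    (hCΦ : ∀ x, |Phi w x| ≤ CΦ) {t : ℝ} (ht : |t| ≤ T ^ (1 - ε)) :
    weight w B T t ≤ 2 ^ B * T ^ (-(2 * ε * B)) * (2 * CΦ ^ 2) := by
  have hT0 : 0 < T := by linarith
  have ha : 1 ≤ T ^ (1 - ε) := Real.one_le_rpow hT (by linarith)
  have h := Extension.weight_le_of_abs_le w B hCΦ hT0 ha ht
  have hx : 2 * (T ^ (1 - ε)) ^ 2 / T ^ 2 = 2 * T ^ (-(2 * ε)) := by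
    rw [← Real.rpow_natCast (T ^ (1 - ε)) 2, ← Real.rpow_mul hT0.le, ← Real.rpow_natCast T 2,
      mul_div_assoc, ← Real.rpow_sub hT0]
    norm_num; ring_nf
  rw [hx, mul_pow, ← Real.rpow_natCast (T ^ (-(2 * ε))) B, ← Real.rpow_mul hT0.le] at h
  convert h using 3; ring

/-- Tail majorant: `|t| (T/|t|)^{2B} ≤ T^{2B}/X^{2B−3} · 2(1+t²)⁻¹` for `|t| ≥ X ≥ 1`, `B ≥ 2`.
[folklore] -/
private theorem tail_majorant {T X t : ℝ} {B : ℕ} (hB : 2 ≤ B) (hX : 1 ≤ X) (ht : X ≤ |t|)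
    (hT : 0 ≤ T) :
    |t| * (T / |t|) ^ (2 * B) ≤ T ^ (2 * B) / X ^ (2 * B - 3) * (2 * (1 + t ^ 2)⁻¹) := by
  have ha : 1 ≤ |t| := hX.trans ht
  have ha0 : 0 < |t| := by linarith
  obtain ⟨k, hk⟩ : ∃ k : ℕ, 2 * B = k + 3 := ⟨2 * B - 3, by omega⟩
  have hk' : 2 * B - 3 = k := by omega
  rw [hk', hk, div_pow, pow_add, pow_add]
  have hXk : X ^ k ≤ |t| ^ k := pow_le_pow_left₀ (by linarith) ht k
  have hXk0 : 0 < X ^ k := by positivity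
  have htk0 : 0 < |t| ^ k := by positivity
  have ht2 : t ^ 2 = |t| ^ 2 := (sq_abs t).symm
  rw [mul_div_assoc', div_le_iff₀ (by positivity), ht2]
  -- goal: |t| * (T^k * T^3) ≤ T^k * T^3 / X^k * (2 * (1 + |t|^2)⁻¹) * (|t|^k * |t|^3)
  have h1 : |t| / 2 ≤ (1 + |t| ^ 2)⁻¹ * |t| ^ 3 := by
    rw [inv_mul_eq_div, div_le_div_iff₀ (by norm_num) (by positivity)]
    have : 1 ≤ |t| ^ 2 := by nlinarith
    nlinarith [mul_le_mul_of_nonneg_left this ha0.le]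
  have h2 : T ^ k * T ^ 3 / X ^ k * |t| ^ k ≥ T ^ k * T ^ 3 := by
    rw [ge_iff_le, div_mul_eq_mul_div, le_div_iff₀ hXk0]
    exact mul_le_mul_of_nonneg_left hXk (by positivity)
  calc |t| * (T ^ k * T ^ 3) ≤ |t| * (T ^ k * T ^ 3 / X ^ k * |t| ^ k) :=
        mul_le_mul_of_nonneg_left h2.le ha0.le
    _ = (T ^ k * T ^ 3 / X ^ k) * (2 * (|t| / 2)) * |t| ^ k := by ring
    _ ≤ (T ^ k * T ^ 3 / X ^ k) * (2 * ((1 + |t| ^ 2)⁻¹ * |t| ^ 3)) * |t| ^ k := by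
        gcongr
    _ = _ := by ring

/-- `|R(t)| ≤ Σ_{n ≤ L} |r(n)|` on the real line (`L ≥ 1`).
[cite: BondarenkoHeap2026, §2.2 p. 6 (R(t))] -/
theorem norm_dirichletPoly_le_sum_abs {L : ℝ} (hL : 1 ≤ L) (r : ℕ → ℝ) (t : ℝ) :
    ‖dirichletPoly r L t‖ ≤ ∑ n ∈ Finset.Icc 1 ⌊L⌋₊, |r n| := by
  have h1 := norm_dirichletPolyC_le hL r t
  rw [dirichletPolyC_ofReal] at h1
  simpa using h1

set_option maxHeartbeats 1600000 in
/-- **The real bookkeeping of Proposition 1** (TeX l.313–325: "by the decay of `W_T` we may restrict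
the `t` integral to `T^{1−ε} ≤ |t| ≤ T^{1+ε}` … `∫ 1_{|u−t|<h/2}(Re Γ'/Γ(¼+iu/2) − log π) du =
h log|t| + o(1) = 2πc(1 + O₁(ε)) + o(1)` … extend the `t` integral to `ℝ` at the cost of a
negligible error"), with the polar-term and Archimedean-constant budgets: for `B ≥ B₀(ε, C, C_L)`
there is `K` such that for every `η > 0` and `T ≥ T₀`, `L ∈ [1, T^{C_L}]`, `|r(n)| ≤ A n^ε`:
`h = 2πc/log T ∈ (0, 1]`; the polar bound of `norm_BC_polar_le` is `≤ (K/4) T^{−C}`;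
`(C₃/2π) h I₀ ≤ (η/2) I₀`; and
`|(h/2π)∫_{|t|≥4} |R|²W_T log(|t|/2) − (h log π/2π) I₀ − c I₀| ≤ ε I₀ + (η/2) I₀ + (K/2) T^{−C}`.
[cite: BondarenkoHeap2026, §2.2 p. 6–7 (proof of Proposition 1)] -/
theorem archimedean_bookkeeping {c ε CL A : ℝ} (C : ℝ) (hc : 0 < c) (hc1 : c ≤ 1) (hε : 0 < ε)
    (hε1 : ε < 1) (hCL : 0 < CL) (hA : 0 ≤ A) (w : Bump) {C₃ : ℝ} (hC₃ : 0 ≤ C₃) :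
    ∃ B₀ : ℕ, ∀ B : ℕ, B₀ ≤ B → ∃ K : ℝ, 0 ≤ K ∧ ∀ η : ℝ, 0 < η → ∃ T₀ : ℝ, ∀ T : ℝ, T₀ ≤ T →
      ∀ L : ℝ, 1 ≤ L → L ≤ T ^ CL → ∀ r : ℕ → ℝ, (∀ n : ℕ, 1 ≤ n → |r n| ≤ A * (n : ℝ) ^ ε) →
        1 ≤ T ∧ 0 < gapWidth c T ∧ gapWidth c T ≤ 1 ∧ 2 ≤ B ∧
        2 * (gapWidth c T * ((∑ n ∈ Finset.Icc 1 ⌊L⌋₊, |r n|) ^ 2 * L *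
            (2 * Real.exp (2 * π * w.σ) * (∫ ξ : ℝ, ‖(w.φ ξ : ℂ)‖) ^ 2) / T ^ (2 * B))) ≤
          K / 2 * T ^ (-C) ∧
        C₃ / (2 * π) * gapWidth c T * I0R w B r L T ≤ η / 2 * I0R w B r L T ∧
        |gapWidth c T / (2 * π) *
              (∫ t in {t : ℝ | 4 ≤ |t|}, ‖dirichletPoly r L t‖ ^ 2 * weight w B T t * Real.log (|t| / 2)) -
            gapWidth c T * Real.log π / (2 * π) * I0R w B r L T - c * I0R w B r L T| ≤
          ε * I0R w B r L T + η / 2 * I0R w B r L T + K / 2 * T ^ (-C) := by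
  obtain ⟨CΦ, hCΦ0, hCΦ⟩ := WeightCalculus.exists_bound_Phi w
  set q : ℝ := (3 * CL * (1 + ε) + C + 7) / (2 * ε) with hq
  refine ⟨⌈q⌉₊ + 2, fun B hB ↦ ?_⟩
  have hB2 : 2 ≤ B := by omega
  have hBr : (2 : ℝ) ≤ B := by exact_mod_cast hB2
  have hεB : 3 * CL * (1 + ε) + C + 7 ≤ 2 * ε * B := by
    have h1 : q ≤ B := by
      have := Nat.le_ceil q
      have h2 : ((⌈q⌉₊ + 2 : ℕ) : ℝ) ≤ B := by exact_mod_cast hB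
      push_cast at h2; linarith
    have := mul_le_mul_of_nonneg_left h1 (by positivity : 0 ≤ 2 * ε)
    rwa [hq, mul_div_cancel₀ _ (by positivity)] at this
  obtain ⟨D, hD0, hD⟩ := Extension.exists_weight_tail_bound w B
  set Φ₁ : ℝ := ∫ ξ : ℝ, ‖(w.φ ξ : ℂ)‖ with hΦ₁
  set K : ℝ := 2 * (8 * 2 ^ B * CΦ ^ 2 * A ^ 2 + 4 * π * D * A ^ 2 +
    8 * Real.exp (2 * π * w.σ) * Φ₁ ^ 2 * A ^ 2) with hK
  have hK0 : 0 ≤ K := by positivity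
  refine ⟨K, hK0, fun η hη ↦ ?_⟩
  set T₀ : ℝ := max (Real.exp (2 * π)) (max ((4 : ℝ) ^ (1 / (1 - ε)))
    (max ((2 : ℝ) ^ (1 / ε)) (Real.exp (2 * (Real.log (2 * π) + C₃ + 1) / η)))) with hT₀
  refine ⟨T₀, fun T hT L hL hLT r hr ↦ ?_⟩
  -- facts about `T`
  have hTe : Real.exp (2 * π) ≤ T := le_trans (le_max_left _ _) hT
  have hT4 : (4 : ℝ) ^ (1 / (1 - ε)) ≤ T :=
    le_trans (le_trans (le_max_left _ _) (le_max_right _ _)) hT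
  have hT2 : (2 : ℝ) ^ (1 / ε) ≤ T :=
    le_trans (le_trans (le_trans (le_max_left _ _) (le_max_right _ _)) (le_max_right _ _)) hT
  have hTη : Real.exp (2 * (Real.log (2 * π) + C₃ + 1) / η) ≤ T :=
    le_trans (le_trans (le_trans (le_max_right _ _) (le_max_right _ _)) (le_max_right _ _)) hT
  have hπ3 : 3 < π := Real.pi_gt_three
  have hT1 : 1 ≤ T := le_trans (Real.one_le_exp (by positivity)) hTe
  have hT0 : 0 < T := by linarith
  have hlogT : 2 * π ≤ Real.log T := by rw [Real.le_log_iff_exp_le hT0]; exact hTe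
  have hlogT0 : 0 < Real.log T := by linarith
  have hlog2π : Real.log (2 * π) ≤ 2 * π := (Real.log_le_sub_one_of_pos (by positivity)).trans (by linarith)
  have hlog2π0 : 0 < Real.log (2 * π) := Real.log_pos (by linarith)
  have hlogπ : Real.log π ≤ Real.log T :=
    Real.log_le_log Real.pi_pos (le_trans (by linarith [Real.add_one_le_exp (2 * π)]) hTe)
  have hlogπ0 : 0 < Real.log π := Real.log_pos (by linarith)
  -- `h = 2πc/log T`
  have hh_def : gapWidth c T = 2 * π * c / Real.log T := rfl
  have hh0 : 0 < gapWidth c T := by rw [hh_def]; positivity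
  have hh1 : gapWidth c T ≤ 1 := by
    rw [hh_def, div_le_one hlogT0]; nlinarith [Real.pi_pos]
  have hh2π : gapWidth c T / (2 * π) = c / Real.log T := by
    rw [hh_def]; field_simp
  have hclog : c / Real.log T ≤ 1 := by
    rw [div_le_one hlogT0]; linarith
  have hclog0 : 0 < c / Real.log T := by positivity
  -- `S = Σ |r(n)| ≤ A T^{C_L(1+ε)}`
  set S : ℝ := ∑ n ∈ Finset.Icc 1 ⌊L⌋₊, |r n| with hS
  have hS0 : 0 ≤ S := Finset.sum_nonneg fun _ _ ↦ abs_nonneg _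
  have hL0 : 0 < L := by linarith
  have hSA : S ≤ A * T ^ (CL * (1 + ε)) := by
    refine (sum_abs_le hA hε.le hL hr).trans (mul_le_mul_of_nonneg_left ?_ hA)
    calc L ^ (1 + ε) ≤ (T ^ CL) ^ (1 + ε) := Real.rpow_le_rpow hL0.le hLT (by linarith)
      _ = T ^ (CL * (1 + ε)) := by rw [← Real.rpow_mul hT0.le]
  have hS2 : S ^ 2 ≤ A ^ 2 * T ^ (2 * CL * (1 + ε)) := by
    calc S ^ 2 ≤ (A * T ^ (CL * (1 + ε))) ^ 2 := pow_le_pow_left₀ hS0 hSA 2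
      _ = A ^ 2 * T ^ (2 * CL * (1 + ε)) := by
          rw [mul_pow, ← Real.rpow_natCast (T ^ (CL * (1 + ε))) 2, ← Real.rpow_mul hT0.le,
            show CL * (1 + ε) * ((2 : ℕ) : ℝ) = 2 * CL * (1 + ε) by push_cast; ring]
  have hRS : ∀ t : ℝ, ‖dirichletPoly r L t‖ ^ 2 ≤ S ^ 2 := fun t ↦
    pow_le_pow_left₀ (norm_nonneg _) (norm_dirichletPoly_le_sum_abs hL r t) 2
  -- `I₀ ≥ 0`
  set g : ℝ → ℝ := fun t ↦ ‖dirichletPoly r L t‖ ^ 2 * weight w B T t with hg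
  have hg0 : ∀ t, 0 ≤ g t := fun t ↦ mul_nonneg (sq_nonneg _) (weight_nonneg w B T t)
  have hgi : Integrable g := integrable_normSq_mul_weight w B r L hT0
  have hI0 : 0 ≤ I0R w B r L T := integral_nonneg hg0
  have hI0_def : I0R w B r L T = ∫ t, g t := rfl
  -- exponent comparison on `T ≥ 1`
  have hTpow : ∀ a b : ℝ, a ≤ b → T ^ a ≤ T ^ b := fun a b hab ↦
    Real.rpow_le_rpow_of_exponent_le hT1 hab
  have hTC0 : 0 < T ^ (-C) := Real.rpow_pos_of_pos hT0 _
  refine ⟨hT1, hh0, hh1, hB2, ?_, ?_, ?_⟩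
  · /- the polar terms: `2 h S² L (2e^{2πσ}‖φ‖₁²) T^{−2B} ≤ 4 e^{2πσ}‖φ‖₁² A² T^{2C_L(1+ε)+C_L−2B}
       ≤ (K/2) T^{−C}` -/
    set E : ℝ := 2 * Real.exp (2 * π * w.σ) * Φ₁ ^ 2 with hE
    have hE0 : 0 ≤ E := by positivity
    have h2B : (T ^ (2 * B) : ℝ) = T ^ ((2 * B : ℕ) : ℝ) := (Real.rpow_natCast T (2 * B)).symm
    have hεB' : 2 * ε * B ≤ 2 * B := by nlinarith only [hε1, hBr]
    have hCLε : 0 < CL * ε := mul_pos hCL hε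
    have hexp : 2 * CL * (1 + ε) + CL - ((2 * B : ℕ) : ℝ) ≤ -C := by
      push_cast
      linarith only [hεB, hεB', hCLε]
    have hXY : S ^ 2 * L * E / T ^ (2 * B) ≤ A ^ 2 * T ^ (2 * CL * (1 + ε)) * T ^ CL * E / T ^ (2 * B) :=
      div_le_div_of_nonneg_right (mul_le_mul_of_nonneg_right
        (mul_le_mul hS2 hLT hL0.le (by positivity)) hE0) (by positivity)
    have hmono : 8 * 2 ^ B * CΦ ^ 2 * A ^ 2 + 4 * π * D * A ^ 2 ≥ 0 := by positivity
    calc 2 * (gapWidth c T * (S ^ 2 * L * E / T ^ (2 * B)))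
        ≤ 2 * (1 * (A ^ 2 * T ^ (2 * CL * (1 + ε)) * T ^ CL * E / T ^ (2 * B))) :=
          mul_le_mul_of_nonneg_left (mul_le_mul hh1 hXY (by positivity) zero_le_one) two_pos.le
      _ = 2 * A ^ 2 * E * (T ^ (2 * CL * (1 + ε)) * T ^ CL / T ^ ((2 * B : ℕ) : ℝ)) := by
          rw [h2B]; ring
      _ = 2 * A ^ 2 * E * T ^ (2 * CL * (1 + ε) + CL - ((2 * B : ℕ) : ℝ)) := by
          rw [Real.rpow_sub hT0, Real.rpow_add hT0]
      _ ≤ 2 * A ^ 2 * E * T ^ (-C) := mul_le_mul_of_nonneg_left (hTpow _ _ hexp) (by positivity)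
      _ ≤ K / 2 * T ^ (-C) := by
          refine mul_le_mul_of_nonneg_right ?_ hTC0.le
          have h1 : 2 * A ^ 2 * E = 4 * (Real.exp (2 * π * w.σ) * Φ₁ ^ 2 * A ^ 2) := by
            rw [hE]; ring
          have h2 : K / 2 = (8 * 2 ^ B * CΦ ^ 2 * A ^ 2 + 4 * π * D * A ^ 2) +
              8 * (Real.exp (2 * π * w.σ) * Φ₁ ^ 2 * A ^ 2) := by
            rw [hK]; ring
          have h3 : 0 ≤ Real.exp (2 * π * w.σ) * Φ₁ ^ 2 * A ^ 2 := by positivity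
          rw [h1, h2]
          linarith only [hmono, h3]
  · /- the Archimedean constant: `(C₃/2π) h I₀ = C₃ c/log T · I₀ ≤ (η/2) I₀` -/
    refine mul_le_mul_of_nonneg_right ?_ hI0
    rw [show C₃ / (2 * π) * gapWidth c T = C₃ * (gapWidth c T / (2 * π)) by ring, hh2π]
    have hlogTη : 2 * (Real.log (2 * π) + C₃ + 1) / η ≤ Real.log T := by
      rw [Real.le_log_iff_exp_le hT0]; exact hTη
    rw [div_le_iff₀ hη] at hlogTη
    rw [← mul_div_assoc, div_le_iff₀ hlogT0]
    have := mul_le_mul_of_nonneg_left hc1 hC₃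
    nlinarith only [hlogTη, this, hlog2π0, hC₃, hη]
  · /- the main bookkeeping -/
    set X₁ : ℝ := T ^ (1 - ε) with hX₁
    set X₂ : ℝ := T ^ (1 + ε) with hX₂
    set Sset : Set ℝ := {t : ℝ | 4 ≤ |t|} with hSset
    set ind : ℝ → ℝ := Sset.indicator (fun t ↦ Real.log (|t| / 2)) with hind
    set ψ : ℝ → ℝ := fun t ↦ ind t - Real.log π - Real.log T with hψ
    -- the ranges
    have hX₁4 : 4 ≤ X₁ := by
      calc (4 : ℝ) = ((4 : ℝ) ^ (1 / (1 - ε))) ^ (1 - ε) := by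
            rw [← Real.rpow_mul (by norm_num), one_div_mul_cancel (by linarith), Real.rpow_one]
        _ ≤ T ^ (1 - ε) := Real.rpow_le_rpow (by positivity) hT4 (by linarith)
    have hX₁T : X₁ ≤ T := by
      calc X₁ = T ^ (1 - ε) := rfl
        _ ≤ T ^ (1 : ℝ) := hTpow _ _ (by linarith)
        _ = T := Real.rpow_one T
    have hX₂T : 2 * T ≤ X₂ := by
      have hTε : 2 ≤ T ^ ε := by
        calc (2 : ℝ) = ((2 : ℝ) ^ (1 / ε)) ^ ε := by
              rw [← Real.rpow_mul (by norm_num), one_div_mul_cancel hε.ne', Real.rpow_one]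
          _ ≤ T ^ ε := Real.rpow_le_rpow (by positivity) hT2 hε.le
      calc 2 * T ≤ T ^ ε * T ^ (1 : ℝ) := by
            rw [Real.rpow_one]; exact mul_le_mul_of_nonneg_right hTε hT0.le
        _ = X₂ := by rw [hX₂, ← Real.rpow_add hT0]; ring_nf
    have hX₂1 : 1 ≤ X₂ := by linarith
    have hlogX₁ : Real.log X₁ = (1 - ε) * Real.log T := Real.log_rpow hT0 _
    have hlogX₂ : Real.log X₂ = (1 + ε) * Real.log T := Real.log_rpow hT0 _
    have hSm : MeasurableSet Sset := (isClosed_le continuous_const continuous_abs).measurableSet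
    have hind_of_ge : ∀ t, 4 ≤ |t| → ind t = Real.log (|t| / 2) := fun t ht ↦ by
      rw [hind, Set.indicator_of_mem (show t ∈ Sset from ht)]
    have hind_of_lt : ∀ t, |t| < 4 → ind t = 0 := fun t ht ↦ by
      rw [hind, Set.indicator_of_notMem (show t ∉ Sset from fun h ↦ absurd h (not_le.mpr ht))]
    -- integrability of `g · ind`
    have hgind_bound : ∀ t, ‖g t * ind t‖ ≤ S ^ 2 * (|t| * weight w B T t) := by
      intro t
      rw [Real.norm_eq_abs, abs_mul, abs_of_nonneg (hg0 t)]
      have hind_le : |ind t| ≤ |t| := by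
        by_cases ht : 4 ≤ |t|
        · rw [hind_of_ge t ht]
          have h2 : Real.log (|t| / 2) ≤ |t| / 2 - 1 := Real.log_le_sub_one_of_pos (by linarith)
          have h3 : 0 ≤ Real.log (|t| / 2) := Real.log_nonneg (by linarith)
          rw [abs_of_nonneg h3]; linarith
        · rw [hind_of_lt t (not_le.mp ht), abs_zero]; exact abs_nonneg t
      calc g t * |ind t| ≤ S ^ 2 * weight w B T t * |t| :=
            mul_le_mul (mul_le_mul_of_nonneg_right (hRS t) (weight_nonneg w B T t)) hind_le
              (abs_nonneg _) (mul_nonneg (sq_nonneg _) (weight_nonneg w B T t))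
        _ = S ^ 2 * (|t| * weight w B T t) := by ring
    have hind_m : Measurable ind :=
      (Real.measurable_log.comp (continuous_abs.measurable.div_const 2)).indicator hSm
    have hgind_int : Integrable (fun t ↦ g t * ind t) :=
      Integrable.mono' ((Extension.integrable_abs_mul_weight w B hT0).const_mul (S ^ 2))
        (hgi.aestronglyMeasurable.mul hind_m.aestronglyMeasurable) (ae_of_all _ hgind_bound)
    -- the expression as one integral
    have hset : ∫ t in Sset, ‖dirichletPoly r L t‖ ^ 2 * weight w B T t * Real.log (|t| / 2) =
        ∫ t, g t * ind t := by
      rw [← integral_indicator hSm]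
      congr 1
      funext t
      by_cases ht : t ∈ Sset
      · rw [Set.indicator_of_mem ht, hind, Set.indicator_of_mem ht]
      · rw [Set.indicator_of_notMem ht, hind, Set.indicator_of_notMem ht, mul_zero]
    have hexpr : gapWidth c T / (2 * π) * (∫ t, g t * ind t) -
        gapWidth c T * Real.log π / (2 * π) * I0R w B r L T - c * I0R w B r L T =
        ∫ t, gapWidth c T / (2 * π) * (g t * ψ t) := by
      have hfun : (fun t ↦ gapWidth c T / (2 * π) * (g t * ψ t)) = fun t ↦
          gapWidth c T / (2 * π) * (g t * ind t) -
            gapWidth c T / (2 * π) * (Real.log π + Real.log T) * g t := by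
        funext t; simp only [hψ]; ring
      rw [hfun, integral_sub (hgind_int.const_mul _) (hgi.const_mul _), integral_const_mul,
        integral_const_mul, ← hI0_def]
      have hc' : gapWidth c T / (2 * π) * Real.log T = c := by
        rw [hh2π, div_mul_cancel₀ _ hlogT0.ne']
      linear_combination (I0R w B r L T) * hc'
    -- the pointwise majorant
    set M₂ : ℝ := 2 * c * S ^ 2 * (2 ^ B * T ^ (-(2 * ε * B)) * (2 * CΦ ^ 2)) with hM₂
    set M₃ : ℝ := 4 * S ^ 2 * D * (T ^ (2 * B) / X₂ ^ (2 * B - 3)) with hM₃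
    set κ : ℝ := c * ε + c * Real.log (2 * π) / Real.log T with hκ
    have hM₂0 : 0 ≤ M₂ := by positivity
    have hM₃0 : 0 ≤ M₃ := by positivity
    have hκ0 : 0 ≤ κ := by positivity
    set F : ℝ → ℝ := fun t ↦ κ * g t + (Set.Icc (-X₁) X₁).indicator (fun _ ↦ M₂) t +
      M₃ * (1 + t ^ 2)⁻¹ with hF
    have hptw : ∀ t, ‖gapWidth c T / (2 * π) * (g t * ψ t)‖ ≤ F t := by
      intro t
      rw [Real.norm_eq_abs, abs_mul, abs_mul, abs_of_pos (by positivity : 0 < gapWidth c T / (2 * π)),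
        abs_of_nonneg (hg0 t), hh2π]
      have hF1 : 0 ≤ κ * g t := mul_nonneg hκ0 (hg0 t)
      have hF2 : 0 ≤ (Set.Icc (-X₁) X₁).indicator (fun _ ↦ M₂) t :=
        Set.indicator_nonneg (fun _ _ ↦ hM₂0) t
      have hF3 : 0 ≤ M₃ * (1 + t ^ 2)⁻¹ := by positivity
      show c / Real.log T * (g t * |ψ t|) ≤
        κ * g t + (Set.Icc (-X₁) X₁).indicator (fun _ ↦ M₂) t + M₃ * (1 + t ^ 2)⁻¹
      rcases le_or_gt |t| X₁ with ht1 | ht1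
      · -- inner range `|t| ≤ T^{1−ε}`
        have hψb : |ψ t| ≤ 2 * Real.log T := by
          by_cases h4 : 4 ≤ |t|
          · have hψt : ψ t = Real.log (|t| / 2) - Real.log π - Real.log T := by
              simp only [hψ, hind_of_ge t h4]
            have hlo : 0 ≤ Real.log (|t| / 2) := Real.log_nonneg (by linarith)
            have hhi : Real.log (|t| / 2) ≤ Real.log T :=
              Real.log_le_log (by linarith) (by linarith)
            rw [hψt, abs_le]; constructor <;> linarith
          · have hψt : ψ t = -Real.log π - Real.log T := by
              simp only [hψ, hind_of_lt t (not_le.mp h4)]; ring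
            rw [hψt, abs_le]; constructor <;> linarith
        have hgb : g t ≤ S ^ 2 * (2 ^ B * T ^ (-(2 * ε * B)) * (2 * CΦ ^ 2)) :=
          mul_le_mul (hRS t) (weight_le_inner w B hT1 hε1 hCΦ ht1) (weight_nonneg w B T t)
            (by positivity)
        rw [Set.indicator_of_mem (Set.mem_Icc.mpr (abs_le.mp ht1))]
        calc c / Real.log T * (g t * |ψ t|)
            ≤ c / Real.log T * (S ^ 2 * (2 ^ B * T ^ (-(2 * ε * B)) * (2 * CΦ ^ 2)) *
                (2 * Real.log T)) :=
              mul_le_mul_of_nonneg_left (mul_le_mul hgb hψb (abs_nonneg _) (by positivity))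
                hclog0.le
          _ = M₂ := by rw [hM₂]; field_simp
          _ ≤ _ := by linarith only [hF1, hF3]
      · rcases lt_or_ge |t| X₂ with ht2 | ht2
        · -- main range `T^{1−ε} < |t| < T^{1+ε}`
          have h4 : 4 ≤ |t| := by linarith
          have hψ_eq : ψ t = Real.log |t| - Real.log T - Real.log (2 * π) := by
            simp only [hψ, hind_of_ge t h4]
            rw [Real.log_div (by linarith) two_ne_zero, Real.log_mul two_ne_zero Real.pi_pos.ne']
            ring
          have hlt_lo : (1 - ε) * Real.log T < Real.log |t| := by
            rw [← hlogX₁]; exact Real.log_lt_log (by linarith) ht1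
          have hlt_hi : Real.log |t| < (1 + ε) * Real.log T := by
            rw [← hlogX₂]; exact Real.log_lt_log (by linarith) ht2
          have hψb : |ψ t| ≤ ε * Real.log T + Real.log (2 * π) := by
            rw [hψ_eq, abs_le]; constructor <;> linarith
          calc c / Real.log T * (g t * |ψ t|)
              ≤ c / Real.log T * (g t * (ε * Real.log T + Real.log (2 * π))) :=
                mul_le_mul_of_nonneg_left (mul_le_mul_of_nonneg_left hψb (hg0 t)) hclog0.le
            _ = κ * g t := by rw [hκ]; field_simp
            _ ≤ _ := by linarith only [hF2, hF3]
        · -- tail `|t| ≥ T^{1+ε} ≥ 2T`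
          have h2T : 2 * T ≤ |t| := hX₂T.trans ht2
          have h4 : 4 ≤ |t| := by linarith
          have hgb : g t ≤ S ^ 2 * (D * (T / |t|) ^ (2 * B)) :=
            mul_le_mul (hRS t) (hD T t hT1 h2T) (weight_nonneg w B T t) (by positivity)
          have hψb : |ψ t| ≤ 2 * |t| := by
            have hψt : ψ t = Real.log (|t| / 2) - Real.log π - Real.log T := by
              simp only [hψ, hind_of_ge t h4]
            have h1 : Real.log (|t| / 2) ≤ |t| / 2 - 1 := Real.log_le_sub_one_of_pos (by linarith)
            have h1' : 0 ≤ Real.log (|t| / 2) := Real.log_nonneg (by linarith)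
            have h2 : Real.log T ≤ T - 1 := Real.log_le_sub_one_of_pos hT0
            have h3 : Real.log π ≤ π - 1 := Real.log_le_sub_one_of_pos Real.pi_pos
            rw [hψt, abs_le]; constructor <;> linarith [Real.pi_le_four]
          have htail := tail_majorant hB2 hX₂1 ht2 hT0.le
          calc c / Real.log T * (g t * |ψ t|)
              ≤ 1 * (S ^ 2 * (D * (T / |t|) ^ (2 * B)) * (2 * |t|)) :=
                mul_le_mul hclog (mul_le_mul hgb hψb (abs_nonneg _) (by positivity))
                  (mul_nonneg (hg0 t) (abs_nonneg _)) zero_le_one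
            _ = 2 * S ^ 2 * D * (|t| * (T / |t|) ^ (2 * B)) := by ring
            _ ≤ 2 * S ^ 2 * D * (T ^ (2 * B) / X₂ ^ (2 * B - 3) * (2 * (1 + t ^ 2)⁻¹)) :=
                mul_le_mul_of_nonneg_left htail (by positivity)
            _ = M₃ * (1 + t ^ 2)⁻¹ := by rw [hM₃]; ring
            _ ≤ _ := by linarith only [hF1, hF2]
    -- integrate the majorant
    have hF1i : Integrable fun t ↦ κ * g t := hgi.const_mul κ
    have hF2i : Integrable fun t ↦ (Set.Icc (-X₁) X₁).indicator (fun _ ↦ M₂) t :=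
      (continuous_const.integrableOn_Icc (a := -X₁) (b := X₁)).integrable_indicator measurableSet_Icc
    have hF3i : Integrable fun t : ℝ ↦ M₃ * (1 + t ^ 2)⁻¹ := integrable_inv_one_add_sq.const_mul M₃
    have hF12i : Integrable fun t ↦ κ * g t + (Set.Icc (-X₁) X₁).indicator (fun _ ↦ M₂) t :=
      hF1i.add hF2i
    have hFi : Integrable F := hF12i.add hF3i
    have hFint : ∫ t, F t = κ * I0R w B r L T + M₂ * (2 * X₁) + M₃ * π := by
      simp only [hF]
      rw [integral_add hF12i hF3i, integral_add hF1i hF2i, integral_const_mul,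
        integral_const_mul, integral_indicator_const _ measurableSet_Icc, integral_univ_inv_one_add_sq,
        ← hI0_def, Real.volume_real_Icc_of_le (by linarith), smul_eq_mul]
      ring
    -- the numerical budget
    have hκI : κ * I0R w B r L T ≤ ε * I0R w B r L T + η / 2 * I0R w B r L T := by
      rw [← add_mul]
      refine mul_le_mul_of_nonneg_right ?_ hI0
      have hlogTη : 2 * (Real.log (2 * π) + C₃ + 1) / η ≤ Real.log T := by
        rw [Real.le_log_iff_exp_le hT0]; exact hTη
      rw [div_le_iff₀ hη] at hlogTη
      have h1 : c * ε ≤ ε := mul_le_of_le_one_left hε.le hc1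
      have h2 : c * Real.log (2 * π) / Real.log T ≤ η / 2 := by
        rw [div_le_iff₀ hlogT0]
        have := mul_le_mul_of_nonneg_right hc1 hlog2π0.le
        linarith only [this, hlogTη, hC₃, hlog2π0]
      rw [hκ]; linarith only [h1, h2]
    have h2B3 : ((2 * B - 3 : ℕ) : ℝ) = 2 * B - 3 := by
      rw [Nat.cast_sub (by omega)]; push_cast; ring
    have hM₂X : M₂ * (2 * X₁) ≤ 8 * 2 ^ B * CΦ ^ 2 * A ^ 2 * T ^ (-C) := by
      have hexp : 2 * CL * (1 + ε) + (-(2 * ε * B) + (1 - ε)) ≤ -C := by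
        have hCLε : 0 < CL * ε := mul_pos hCL hε
        linarith only [hεB, hCLε, hCL, hε]
      calc M₂ * (2 * X₁) = 8 * c * 2 ^ B * CΦ ^ 2 * S ^ 2 * (T ^ (-(2 * ε * B)) * T ^ (1 - ε)) := by
            rw [hM₂]; ring
        _ ≤ 8 * 1 * 2 ^ B * CΦ ^ 2 * (A ^ 2 * T ^ (2 * CL * (1 + ε))) *
              (T ^ (-(2 * ε * B)) * T ^ (1 - ε)) := by
            gcongr
        _ = 8 * 2 ^ B * CΦ ^ 2 * A ^ 2 * T ^ (2 * CL * (1 + ε) + (-(2 * ε * B) + (1 - ε))) := by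
            rw [Real.rpow_add hT0, Real.rpow_add hT0]; ring
        _ ≤ 8 * 2 ^ B * CΦ ^ 2 * A ^ 2 * T ^ (-C) :=
            mul_le_mul_of_nonneg_left (hTpow _ _ hexp) (by positivity)
    have hM₃π : M₃ * π ≤ 4 * π * D * A ^ 2 * T ^ (-C) := by
      have hpow : T ^ (2 * B) / X₂ ^ (2 * B - 3) = T ^ (((2 * B : ℕ) : ℝ) - (1 + ε) * (2 * B - 3)) := by
        rw [hX₂, ← Real.rpow_natCast T (2 * B), ← Real.rpow_natCast (T ^ (1 + ε)) (2 * B - 3),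
          ← Real.rpow_mul hT0.le, h2B3, Real.rpow_sub hT0]
      have hexp : 2 * CL * (1 + ε) + (((2 * B : ℕ) : ℝ) - (1 + ε) * (2 * B - 3)) ≤ -C := by
        push_cast
        have hCLε : 0 < CL * ε := mul_pos hCL hε
        linarith only [hεB, hCLε, hCL, hε, hε1]
      calc M₃ * π = 4 * π * D * S ^ 2 * (T ^ (2 * B) / X₂ ^ (2 * B - 3)) := by rw [hM₃]; ring
        _ ≤ 4 * π * D * (A ^ 2 * T ^ (2 * CL * (1 + ε))) * (T ^ (2 * B) / X₂ ^ (2 * B - 3)) := by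
            gcongr
        _ = 4 * π * D * A ^ 2 * T ^ (2 * CL * (1 + ε) + (((2 * B : ℕ) : ℝ) - (1 + ε) * (2 * B - 3))) := by
            rw [hpow, Real.rpow_add hT0]; ring
        _ ≤ 4 * π * D * A ^ 2 * T ^ (-C) := mul_le_mul_of_nonneg_left (hTpow _ _ hexp) (by positivity)
    have hKhalf : 8 * 2 ^ B * CΦ ^ 2 * A ^ 2 * T ^ (-C) + 4 * π * D * A ^ 2 * T ^ (-C) ≤
        K / 2 * T ^ (-C) := by
      have h3 : 0 ≤ Real.exp (2 * π * w.σ) * Φ₁ ^ 2 * A ^ 2 * T ^ (-C) := by positivity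
      rw [hK]; linarith only [h3]
    -- conclusion
    rw [hset, hexpr]
    calc |∫ t, gapWidth c T / (2 * π) * (g t * ψ t)|
        = ‖∫ t, gapWidth c T / (2 * π) * (g t * ψ t)‖ := (Real.norm_eq_abs _).symm
      _ ≤ ∫ t, ‖gapWidth c T / (2 * π) * (g t * ψ t)‖ := norm_integral_le_integral_norm _
      _ ≤ ∫ t, F t := integral_mono_of_nonneg (ae_of_all _ fun t ↦ norm_nonneg _) hFi (ae_of_all _ hptw)
      _ = κ * I0R w B r L T + M₂ * (2 * X₁) + M₃ * π := hFint
      _ ≤ ε * I0R w B r L T + η / 2 * I0R w B r L T + K / 2 * T ^ (-C) := by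
          linarith only [hκI, hM₂X, hM₃π, hKhalf]

/-! ### Assembly: Proposition 1 from the two explicit-formula sides -/

open Literature.Analysis.SpecialFunctions in
/-- **Proposition 1 from its sides (M4-α).** Assume, for all parameters with `T ≥ 1`,
`0 < h = gapWidth c T ≤ 1`, `L ≥ 1`, `B ≥ 2`: (zero side) `I₁ = Σ_ρ m(ρ) B_{T,h}(γ_ρ)`;
(prime side) `Σ_n Λ(n)n^{−1/2}(1/2π)(B̂(log n/2π) + B̂(−log n/2π)) = (2/π)·primeSum`;
(`ξ = 0`) `B̂(0) = h I₀`; and (Archimedean side) `|(1/2π)∫ B_{T,h} Re ψ(¼+iu/2) du −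
(h/2π)∫_{|t|≥4}|R|²W_T log(|t|/2)| ≤ (C/2π) h I₀`. Then Proposition 1 holds: the explicit formula
`explicit_formula_BC`, the polar bound `norm_BC_polar_le` and `archimedean_bookkeeping`.
[cite: BondarenkoHeap2026, §2.2 Proposition 1 p. 6–7] -/
theorem proposition1_of_sides
    (hZ : ∀ (c : ℝ) (w : Bump) (B : ℕ) (r : ℕ → ℝ) (L T : ℝ), 1 ≤ T → 0 < gapWidth c T →
      gapWidth c T ≤ 1 → 1 ≤ L → 2 ≤ B →
      (I1R c w B r L T : ℂ) = ∑' ρ : ZetaZeros.riemannZetaNontrivialZeros,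
        (riemannZetaZeroOrder (ρ : ℂ) : ℂ) * BC c w B r L T (((ρ : ℂ).im : ℝ) : ℂ))
    (hP : ∀ (c : ℝ) (w : Bump) (B : ℕ) (r : ℕ → ℝ) (L T : ℝ), 1 ≤ T → 0 < gapWidth c T →
      gapWidth c T ≤ 1 → 1 ≤ L → 2 ≤ B →
      ∑' n : ℕ, ((ArithmeticFunction.vonMangoldt n : ℝ) : ℂ) / (Real.sqrt n : ℂ) *
          ((1 / (2 * π) : ℂ) * (𝓕 (fun x : ℝ ↦ BC c w B r L T x) (Real.log n / (2 * π))
            + 𝓕 (fun x : ℝ ↦ BC c w B r L T x) (-(Real.log n / (2 * π))))) =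
        ((2 / π * primeSum c w B r L T : ℝ) : ℂ))
    (h0 : ∀ (c : ℝ) (w : Bump) (B : ℕ) (r : ℕ → ℝ) (L T : ℝ), 1 ≤ T → 0 < gapWidth c T →
      gapWidth c T ≤ 1 → 1 ≤ L → 2 ≤ B →
      𝓕 (fun x : ℝ ↦ BC c w B r L T x) 0 = ((gapWidth c T * I0R w B r L T : ℝ) : ℂ))
    (hM3 : ∃ C : ℝ, 0 ≤ C ∧ ∀ (c : ℝ) (w : Bump) (B : ℕ) (r : ℕ → ℝ) (L T : ℝ), 0 < T →
      0 < gapWidth c T → gapWidth c T ≤ 1 →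
      |1 / (2 * π) * (∫ u, bWindow c w B r L T u * reDigammaQuarter u) -
          gapWidth c T / (2 * π) * ∫ t in {t : ℝ | 4 ≤ |t|},
            ‖dirichletPoly r L t‖ ^ 2 * weight w B T t * Real.log (|t| / 2)| ≤
        C / (2 * π) * gapWidth c T * I0R w B r L T) :
    proposition1 := by
  intro hRH c ε C CL A hc hc1 hε hε1 _hC hCL hA w
  obtain ⟨C₃, hC₃0, hM3'⟩ := hM3
  obtain ⟨B₀, hB₀⟩ := archimedean_bookkeeping C hc hc1 hε hε1 hCL hA w hC₃0
  refine ⟨B₀, fun B hB ↦ ?_⟩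
  obtain ⟨K, -, hK⟩ := hB₀ B hB
  refine ⟨K, fun η hη ↦ ?_⟩
  obtain ⟨T₀, hT₀⟩ := hK η hη
  refine ⟨T₀, fun T hT L hL hLT r hr ↦ ?_⟩
  obtain ⟨hT1, hh0, hh1, hB2, hpolar, harch, hmain⟩ := hT₀ T hT L hL hLT r hr
  have hT0 : 0 < T := by linarith
  set h : ℝ := gapWidth c T with hh
  set PS : ℝ := primeSum c w B r L T
  set I0 : ℝ := I0R w B r L T
  set X : ℝ := ∫ u, bWindow c w B r L T u * reDigammaQuarter u with hX
  set Main : ℝ := ∫ t in {t : ℝ | 4 ≤ |t|}, ‖dirichletPoly r L t‖ ^ 2 * weight w B T t *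
    Real.log (|t| / 2) with hMain
  -- the explicit formula for `B_{T,h}` with both sides identified
  have hEF := (explicit_formula_BC hRH c w B r hL hT1 hB2 hh0 hh1).2
  rw [← hZ c w B r L T hT1 hh0 hh1 hL hB2, hP c w B r L T hT1 hh0 hh1 hL hB2,
    h0 c w B r L T hT1 hh0 hh1 hL hB2] at hEF
  have hdig : ∫ u : ℝ, BC c w B r L T u * (reDigammaQuarter u : ℂ) = (X : ℂ) := by
    rw [hX, ← integral_complex_ofReal]
    congr 1
    funext u
    rw [BC_ofReal hh0.le, bWindow, integral_Icc_eq_integral_Ioo]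
    push_cast
    ring
  rw [hdig] at hEF
  -- the polar terms
  set P : ℂ := BC c w B r L T (I / 2) + BC c w B r L T (-(I / 2)) with hPdef
  set rest : ℝ := -(2 / π * PS) + (1 / (2 * π) * X - 1 / (2 * π) * (h * I0) * Real.log π) with hrest
  have hdiff : ((I1R c w B r L T - rest : ℝ) : ℂ) = P := by
    rw [hrest, hPdef]
    push_cast
    rw [hEF]
    push_cast
    ring
  have hpol : |I1R c w B r L T - rest| ≤ K / 2 * T ^ (-C) := by
    rw [← Real.norm_eq_abs, ← Complex.norm_real, hdiff, hPdef]
    have h1 := norm_BC_polar_le c w B r hL hT1 hh0.le hh1 (z₀ := I / 2) (by simp) (by simp)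
    have h2 := norm_BC_polar_le c w B r hL hT1 hh0.le hh1 (z₀ := -(I / 2)) (by simp) (by simp)
    refine (norm_add_le _ _).trans ?_
    linarith
  -- the Archimedean side
  have hA3 := hM3' c w B r L T hT0 hh0 hh1
  -- assemble
  have hsplit : I1R c w B r L T - (c * I0 - 2 / π * PS) =
      (I1R c w B r L T - rest) + (1 / (2 * π) * X - h / (2 * π) * Main) +
        (h / (2 * π) * Main - h * Real.log π / (2 * π) * I0 - c * I0) := by
    rw [hrest]; ring
  rw [hsplit]
  refine (abs_add_le _ _).trans ((add_le_add (abs_add_le _ _) le_rfl).trans ?_)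
  linarith

end Prop1

/-- **Proposition 1 holds** [BondarenkoHeap2026, §2.2 Prop. 1, p. 7]: "Assume RH. Then for any fixed
`ε > 0`, `I₁ = cI₀ − (2/π) Σ_{m,n ≤ L, k ≥ 2} Λ(k)g_h(k)r(m)r(n)(kmn)^{−1/2} Ŵ_T(log(km/n)/2π)
+ O₁(εI₀) + o(I₀) + O_ε(T^{−C})`" — in the tree's quantified form `proposition1`, discharged from
modules (M1)–(M3) by `Prop1.proposition1_of_sides`. [cite: BondarenkoHeap2026, §2.2 Proposition 1] -/
theorem proposition1_holds : BondarenkoHeap2026.proposition1 :=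
  Prop1.proposition1_of_sides
    (fun c w B r L T hT hh0 hh1 _ _ ↦
      (Prop1.tsum_zeroSide_BC_eq c w B r L (by linarith) hh0.le (by linarith)).symm)
    (fun c w B r L T hT hh0 _ _ _ ↦ Prop1.primeSide_BC_eq_primeSum (by linarith) hh0 w B r L)
    (fun c w B r L T hT hh0 _ _ _ ↦ Prop1.fourier_BC_zero_eq_gapWidth_mul_I0R (by linarith) hh0 w B r L)
    Arch.exists_abs_archimedean_bWindow_sub_le

/-! ### Proposition 1 for every window constant `c ≥ 1` (the large-gap range)

For the LARGE-gap half of the Montgomery–Odlyzko criterion the window constant is `c ≈ 2`; the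
typed `proposition1` carries `0 < c ≤ 1` only because the Archimedean error is printed `ε I₀`.
The same bookkeeping with thresholds `T₀ ∋ e^{2πc}` gives the error `cε I₀` for every `c ≥ 1`
(landau-siegel seat ls-lit-r2 g7; theorems only, 0 `def`, 0 named facts). -/

namespace Prop1

set_option maxHeartbeats 1600000 in
/-- **The real bookkeeping of Proposition 1 for a window constant `c ≥ 1`** (companion of
`archimedean_bookkeeping`, whose `c ≤ 1` only serves to print the Archimedean error as `ε I₀`;
for general `c` the same lines give `c ε I₀` — "for `c > 1` the printed `O₁(ε I₀)` reads
`O₁(cε I₀)`", docstring of `proposition1` — with thresholds `T₀ ∋ e^{2πc}` so that still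
`h = 2πc/log T ≤ 1`). Same text (TeX l.313–325: "by the decay of `W_T` we may restrict
the `t` integral to `T^{1−ε} ≤ |t| ≤ T^{1+ε}` … `∫ 1_{|u−t|<h/2}(Re Γ'/Γ(¼+iu/2) − log π) du =
h log|t| + o(1) = 2πc(1 + O₁(ε)) + o(1)` … extend the `t` integral to `ℝ` at the cost of a
negligible error"), with the polar-term and Archimedean-constant budgets: for `B ≥ B₀(ε, C, C_L)`
there is `K` such that for every `η > 0` and `T ≥ T₀`, `L ∈ [1, T^{C_L}]`, `|r(n)| ≤ A n^ε`:
`h = 2πc/log T ∈ (0, 1]`; the polar bound of `norm_BC_polar_le` is `≤ (K/4) T^{−C}`;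
`(C₃/2π) h I₀ ≤ (η/2) I₀`; and
`|(h/2π)∫_{|t|≥4} |R|²W_T log(|t|/2) − (h log π/2π) I₀ − c I₀| ≤ cε I₀ + (η/2) I₀ + (K/2) T^{−C}`.
[cite: BondarenkoHeap2026, §2.2 p. 6–7 (proof of Proposition 1; "for c > 1 the O₁(εI₀) reads O₁(cεI₀)")] -/
theorem archimedean_bookkeeping_of_one_le {c ε CL A : ℝ} (C : ℝ) (hc1 : 1 ≤ c) (hε : 0 < ε)
    (hε1 : ε < 1) (hCL : 0 < CL) (hA : 0 ≤ A) (w : Bump) {C₃ : ℝ} (hC₃ : 0 ≤ C₃) :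
    ∃ B₀ : ℕ, ∀ B : ℕ, B₀ ≤ B → ∃ K : ℝ, 0 ≤ K ∧ ∀ η : ℝ, 0 < η → ∃ T₀ : ℝ, ∀ T : ℝ, T₀ ≤ T →
      ∀ L : ℝ, 1 ≤ L → L ≤ T ^ CL → ∀ r : ℕ → ℝ, (∀ n : ℕ, 1 ≤ n → |r n| ≤ A * (n : ℝ) ^ ε) →
        1 ≤ T ∧ 0 < gapWidth c T ∧ gapWidth c T ≤ 1 ∧ 2 ≤ B ∧
        2 * (gapWidth c T * ((∑ n ∈ Finset.Icc 1 ⌊L⌋₊, |r n|) ^ 2 * L *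
            (2 * Real.exp (2 * π * w.σ) * (∫ ξ : ℝ, ‖(w.φ ξ : ℂ)‖) ^ 2) / T ^ (2 * B))) ≤
          K / 2 * T ^ (-C) ∧
        C₃ / (2 * π) * gapWidth c T * I0R w B r L T ≤ η / 2 * I0R w B r L T ∧
        |gapWidth c T / (2 * π) *
              (∫ t in {t : ℝ | 4 ≤ |t|}, ‖dirichletPoly r L t‖ ^ 2 * weight w B T t * Real.log (|t| / 2)) -
            gapWidth c T * Real.log π / (2 * π) * I0R w B r L T - c * I0R w B r L T| ≤
          c * ε * I0R w B r L T + η / 2 * I0R w B r L T + K / 2 * T ^ (-C) := by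
  have hc : 0 < c := by linarith
  obtain ⟨CΦ, hCΦ0, hCΦ⟩ := WeightCalculus.exists_bound_Phi w
  set q : ℝ := (3 * CL * (1 + ε) + C + 7) / (2 * ε) with hq
  refine ⟨⌈q⌉₊ + 2, fun B hB ↦ ?_⟩
  have hB2 : 2 ≤ B := by omega
  have hBr : (2 : ℝ) ≤ B := by exact_mod_cast hB2
  have hεB : 3 * CL * (1 + ε) + C + 7 ≤ 2 * ε * B := by
    have h1 : q ≤ B := by
      have := Nat.le_ceil q
      have h2 : ((⌈q⌉₊ + 2 : ℕ) : ℝ) ≤ B := by exact_mod_cast hB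
      push_cast at h2; linarith
    have := mul_le_mul_of_nonneg_left h1 (by positivity : 0 ≤ 2 * ε)
    rwa [hq, mul_div_cancel₀ _ (by positivity)] at this
  obtain ⟨D, hD0, hD⟩ := Extension.exists_weight_tail_bound w B
  set Φ₁ : ℝ := ∫ ξ : ℝ, ‖(w.φ ξ : ℂ)‖ with hΦ₁
  set K : ℝ := 2 * (8 * c * 2 ^ B * CΦ ^ 2 * A ^ 2 + 4 * π * D * A ^ 2 +
    8 * Real.exp (2 * π * w.σ) * Φ₁ ^ 2 * A ^ 2) with hK
  have hK0 : 0 ≤ K := by positivity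
  refine ⟨K, hK0, fun η hη ↦ ?_⟩
  set T₀ : ℝ := max (Real.exp (2 * π * c)) (max ((4 : ℝ) ^ (1 / (1 - ε)))
    (max ((2 : ℝ) ^ (1 / ε)) (Real.exp (2 * c * (Real.log (2 * π) + C₃ + 1) / η)))) with hT₀
  refine ⟨T₀, fun T hT L hL hLT r hr ↦ ?_⟩
  -- facts about `T`
  have hTe : Real.exp (2 * π * c) ≤ T := le_trans (le_max_left _ _) hT
  have hT4 : (4 : ℝ) ^ (1 / (1 - ε)) ≤ T :=
    le_trans (le_trans (le_max_left _ _) (le_max_right _ _)) hT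
  have hT2 : (2 : ℝ) ^ (1 / ε) ≤ T :=
    le_trans (le_trans (le_trans (le_max_left _ _) (le_max_right _ _)) (le_max_right _ _)) hT
  have hTη : Real.exp (2 * c * (Real.log (2 * π) + C₃ + 1) / η) ≤ T :=
    le_trans (le_trans (le_trans (le_max_right _ _) (le_max_right _ _)) (le_max_right _ _)) hT
  have hπ3 : 3 < π := Real.pi_gt_three
  have hT1 : 1 ≤ T := le_trans (Real.one_le_exp (by positivity)) hTe
  have hT0 : 0 < T := by linarith
  have hlogTc : 2 * π * c ≤ Real.log T := by rw [Real.le_log_iff_exp_le hT0]; exact hTe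
  have hlogT : 2 * π ≤ Real.log T := le_trans (by nlinarith [hπ3, hc1]) hlogTc
  have hlogT0 : 0 < Real.log T := by linarith
  have hlog2π : Real.log (2 * π) ≤ 2 * π := (Real.log_le_sub_one_of_pos (by positivity)).trans (by linarith)
  have hlog2π0 : 0 < Real.log (2 * π) := Real.log_pos (by linarith)
  have hlogπ : Real.log π ≤ Real.log T :=
    Real.log_le_log Real.pi_pos
      (le_trans (by nlinarith [Real.add_one_le_exp (2 * π * c), hπ3, hc1]) hTe)
  have hlogπ0 : 0 < Real.log π := Real.log_pos (by linarith)
  -- `h = 2πc/log T`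
  have hh_def : gapWidth c T = 2 * π * c / Real.log T := rfl
  have hh0 : 0 < gapWidth c T := by rw [hh_def]; positivity
  have hh1 : gapWidth c T ≤ 1 := by
    rw [hh_def, div_le_one hlogT0]; exact hlogTc
  have hh2π : gapWidth c T / (2 * π) = c / Real.log T := by
    rw [hh_def]; field_simp
  have hclog : c / Real.log T ≤ 1 := by
    rw [div_le_one hlogT0]; nlinarith [hπ3, hc]
  have hclog0 : 0 < c / Real.log T := by positivity
  -- `S = Σ |r(n)| ≤ A T^{C_L(1+ε)}`
  set S : ℝ := ∑ n ∈ Finset.Icc 1 ⌊L⌋₊, |r n| with hS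
  have hS0 : 0 ≤ S := Finset.sum_nonneg fun _ _ ↦ abs_nonneg _
  have hL0 : 0 < L := by linarith
  have hSA : S ≤ A * T ^ (CL * (1 + ε)) := by
    refine (sum_abs_le hA hε.le hL hr).trans (mul_le_mul_of_nonneg_left ?_ hA)
    calc L ^ (1 + ε) ≤ (T ^ CL) ^ (1 + ε) := Real.rpow_le_rpow hL0.le hLT (by linarith)
      _ = T ^ (CL * (1 + ε)) := by rw [← Real.rpow_mul hT0.le]
  have hS2 : S ^ 2 ≤ A ^ 2 * T ^ (2 * CL * (1 + ε)) := by
    calc S ^ 2 ≤ (A * T ^ (CL * (1 + ε))) ^ 2 := pow_le_pow_left₀ hS0 hSA 2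
      _ = A ^ 2 * T ^ (2 * CL * (1 + ε)) := by
          rw [mul_pow, ← Real.rpow_natCast (T ^ (CL * (1 + ε))) 2, ← Real.rpow_mul hT0.le,
            show CL * (1 + ε) * ((2 : ℕ) : ℝ) = 2 * CL * (1 + ε) by push_cast; ring]
  have hRS : ∀ t : ℝ, ‖dirichletPoly r L t‖ ^ 2 ≤ S ^ 2 := fun t ↦
    pow_le_pow_left₀ (norm_nonneg _) (norm_dirichletPoly_le_sum_abs hL r t) 2
  -- `I₀ ≥ 0`
  set g : ℝ → ℝ := fun t ↦ ‖dirichletPoly r L t‖ ^ 2 * weight w B T t with hg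
  have hg0 : ∀ t, 0 ≤ g t := fun t ↦ mul_nonneg (sq_nonneg _) (weight_nonneg w B T t)
  have hgi : Integrable g := integrable_normSq_mul_weight w B r L hT0
  have hI0 : 0 ≤ I0R w B r L T := integral_nonneg hg0
  have hI0_def : I0R w B r L T = ∫ t, g t := rfl
  -- exponent comparison on `T ≥ 1`
  have hTpow : ∀ a b : ℝ, a ≤ b → T ^ a ≤ T ^ b := fun a b hab ↦
    Real.rpow_le_rpow_of_exponent_le hT1 hab
  have hTC0 : 0 < T ^ (-C) := Real.rpow_pos_of_pos hT0 _
  refine ⟨hT1, hh0, hh1, hB2, ?_, ?_, ?_⟩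
  · /- the polar terms: `2 h S² L (2e^{2πσ}‖φ‖₁²) T^{−2B} ≤ 4 e^{2πσ}‖φ‖₁² A² T^{2C_L(1+ε)+C_L−2B}
       ≤ (K/2) T^{−C}` -/
    set E : ℝ := 2 * Real.exp (2 * π * w.σ) * Φ₁ ^ 2 with hE
    have hE0 : 0 ≤ E := by positivity
    have h2B : (T ^ (2 * B) : ℝ) = T ^ ((2 * B : ℕ) : ℝ) := (Real.rpow_natCast T (2 * B)).symm
    have hεB' : 2 * ε * B ≤ 2 * B := by nlinarith only [hε1, hBr]
    have hCLε : 0 < CL * ε := mul_pos hCL hε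
    have hexp : 2 * CL * (1 + ε) + CL - ((2 * B : ℕ) : ℝ) ≤ -C := by
      push_cast
      linarith only [hεB, hεB', hCLε]
    have hXY : S ^ 2 * L * E / T ^ (2 * B) ≤ A ^ 2 * T ^ (2 * CL * (1 + ε)) * T ^ CL * E / T ^ (2 * B) :=
      div_le_div_of_nonneg_right (mul_le_mul_of_nonneg_right
        (mul_le_mul hS2 hLT hL0.le (by positivity)) hE0) (by positivity)
    have hmono : 8 * c * 2 ^ B * CΦ ^ 2 * A ^ 2 + 4 * π * D * A ^ 2 ≥ 0 := by positivity
    calc 2 * (gapWidth c T * (S ^ 2 * L * E / T ^ (2 * B)))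
        ≤ 2 * (1 * (A ^ 2 * T ^ (2 * CL * (1 + ε)) * T ^ CL * E / T ^ (2 * B))) :=
          mul_le_mul_of_nonneg_left (mul_le_mul hh1 hXY (by positivity) zero_le_one) two_pos.le
      _ = 2 * A ^ 2 * E * (T ^ (2 * CL * (1 + ε)) * T ^ CL / T ^ ((2 * B : ℕ) : ℝ)) := by
          rw [h2B]; ring
      _ = 2 * A ^ 2 * E * T ^ (2 * CL * (1 + ε) + CL - ((2 * B : ℕ) : ℝ)) := by
          rw [Real.rpow_sub hT0, Real.rpow_add hT0]
      _ ≤ 2 * A ^ 2 * E * T ^ (-C) := mul_le_mul_of_nonneg_left (hTpow _ _ hexp) (by positivity)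
      _ ≤ K / 2 * T ^ (-C) := by
          refine mul_le_mul_of_nonneg_right ?_ hTC0.le
          have h1 : 2 * A ^ 2 * E = 4 * (Real.exp (2 * π * w.σ) * Φ₁ ^ 2 * A ^ 2) := by
            rw [hE]; ring
          have h2 : K / 2 = (8 * c * 2 ^ B * CΦ ^ 2 * A ^ 2 + 4 * π * D * A ^ 2) +
              8 * (Real.exp (2 * π * w.σ) * Φ₁ ^ 2 * A ^ 2) := by
            rw [hK]; ring
          have h3 : 0 ≤ Real.exp (2 * π * w.σ) * Φ₁ ^ 2 * A ^ 2 := by positivity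
          rw [h1, h2]
          linarith only [hmono, h3]
  · /- the Archimedean constant: `(C₃/2π) h I₀ = C₃ c/log T · I₀ ≤ (η/2) I₀` -/
    refine mul_le_mul_of_nonneg_right ?_ hI0
    rw [show C₃ / (2 * π) * gapWidth c T = C₃ * (gapWidth c T / (2 * π)) by ring, hh2π]
    have hlogTη : 2 * c * (Real.log (2 * π) + C₃ + 1) / η ≤ Real.log T := by
      rw [Real.le_log_iff_exp_le hT0]; exact hTη
    rw [div_le_iff₀ hη] at hlogTη
    rw [← mul_div_assoc, div_le_iff₀ hlogT0]
    have h1 : 0 ≤ c * Real.log (2 * π) := by positivity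
    nlinarith only [hlogTη, h1, hC₃, hη, hc]
  · /- the main bookkeeping -/
    set X₁ : ℝ := T ^ (1 - ε) with hX₁
    set X₂ : ℝ := T ^ (1 + ε) with hX₂
    set Sset : Set ℝ := {t : ℝ | 4 ≤ |t|} with hSset
    set ind : ℝ → ℝ := Sset.indicator (fun t ↦ Real.log (|t| / 2)) with hind
    set ψ : ℝ → ℝ := fun t ↦ ind t - Real.log π - Real.log T with hψ
    -- the ranges
    have hX₁4 : 4 ≤ X₁ := by
      calc (4 : ℝ) = ((4 : ℝ) ^ (1 / (1 - ε))) ^ (1 - ε) := by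
            rw [← Real.rpow_mul (by norm_num), one_div_mul_cancel (by linarith), Real.rpow_one]
        _ ≤ T ^ (1 - ε) := Real.rpow_le_rpow (by positivity) hT4 (by linarith)
    have hX₁T : X₁ ≤ T := by
      calc X₁ = T ^ (1 - ε) := rfl
        _ ≤ T ^ (1 : ℝ) := hTpow _ _ (by linarith)
        _ = T := Real.rpow_one T
    have hX₂T : 2 * T ≤ X₂ := by
      have hTε : 2 ≤ T ^ ε := by
        calc (2 : ℝ) = ((2 : ℝ) ^ (1 / ε)) ^ ε := by
              rw [← Real.rpow_mul (by norm_num), one_div_mul_cancel hε.ne', Real.rpow_one]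
          _ ≤ T ^ ε := Real.rpow_le_rpow (by positivity) hT2 hε.le
      calc 2 * T ≤ T ^ ε * T ^ (1 : ℝ) := by
            rw [Real.rpow_one]; exact mul_le_mul_of_nonneg_right hTε hT0.le
        _ = X₂ := by rw [hX₂, ← Real.rpow_add hT0]; ring_nf
    have hX₂1 : 1 ≤ X₂ := by linarith
    have hlogX₁ : Real.log X₁ = (1 - ε) * Real.log T := Real.log_rpow hT0 _
    have hlogX₂ : Real.log X₂ = (1 + ε) * Real.log T := Real.log_rpow hT0 _
    have hSm : MeasurableSet Sset := (isClosed_le continuous_const continuous_abs).measurableSet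
    have hind_of_ge : ∀ t, 4 ≤ |t| → ind t = Real.log (|t| / 2) := fun t ht ↦ by
      rw [hind, Set.indicator_of_mem (show t ∈ Sset from ht)]
    have hind_of_lt : ∀ t, |t| < 4 → ind t = 0 := fun t ht ↦ by
      rw [hind, Set.indicator_of_notMem (show t ∉ Sset from fun h ↦ absurd h (not_le.mpr ht))]
    -- integrability of `g · ind`
    have hgind_bound : ∀ t, ‖g t * ind t‖ ≤ S ^ 2 * (|t| * weight w B T t) := by
      intro t
      rw [Real.norm_eq_abs, abs_mul, abs_of_nonneg (hg0 t)]
      have hind_le : |ind t| ≤ |t| := by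
        by_cases ht : 4 ≤ |t|
        · rw [hind_of_ge t ht]
          have h2 : Real.log (|t| / 2) ≤ |t| / 2 - 1 := Real.log_le_sub_one_of_pos (by linarith)
          have h3 : 0 ≤ Real.log (|t| / 2) := Real.log_nonneg (by linarith)
          rw [abs_of_nonneg h3]; linarith
        · rw [hind_of_lt t (not_le.mp ht), abs_zero]; exact abs_nonneg t
      calc g t * |ind t| ≤ S ^ 2 * weight w B T t * |t| :=
            mul_le_mul (mul_le_mul_of_nonneg_right (hRS t) (weight_nonneg w B T t)) hind_le
              (abs_nonneg _) (mul_nonneg (sq_nonneg _) (weight_nonneg w B T t))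
        _ = S ^ 2 * (|t| * weight w B T t) := by ring
    have hind_m : Measurable ind :=
      (Real.measurable_log.comp (continuous_abs.measurable.div_const 2)).indicator hSm
    have hgind_int : Integrable (fun t ↦ g t * ind t) :=
      Integrable.mono' ((Extension.integrable_abs_mul_weight w B hT0).const_mul (S ^ 2))
        (hgi.aestronglyMeasurable.mul hind_m.aestronglyMeasurable) (ae_of_all _ hgind_bound)
    -- the expression as one integral
    have hset : ∫ t in Sset, ‖dirichletPoly r L t‖ ^ 2 * weight w B T t * Real.log (|t| / 2) =
        ∫ t, g t * ind t := by
      rw [← integral_indicator hSm]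
      congr 1
      funext t
      by_cases ht : t ∈ Sset
      · rw [Set.indicator_of_mem ht, hind, Set.indicator_of_mem ht]
      · rw [Set.indicator_of_notMem ht, hind, Set.indicator_of_notMem ht, mul_zero]
    have hexpr : gapWidth c T / (2 * π) * (∫ t, g t * ind t) -
        gapWidth c T * Real.log π / (2 * π) * I0R w B r L T - c * I0R w B r L T =
        ∫ t, gapWidth c T / (2 * π) * (g t * ψ t) := by
      have hfun : (fun t ↦ gapWidth c T / (2 * π) * (g t * ψ t)) = fun t ↦
          gapWidth c T / (2 * π) * (g t * ind t) -
            gapWidth c T / (2 * π) * (Real.log π + Real.log T) * g t := by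
        funext t; simp only [hψ]; ring
      rw [hfun, integral_sub (hgind_int.const_mul _) (hgi.const_mul _), integral_const_mul,
        integral_const_mul, ← hI0_def]
      have hc' : gapWidth c T / (2 * π) * Real.log T = c := by
        rw [hh2π, div_mul_cancel₀ _ hlogT0.ne']
      linear_combination (I0R w B r L T) * hc'
    -- the pointwise majorant
    set M₂ : ℝ := 2 * c * S ^ 2 * (2 ^ B * T ^ (-(2 * ε * B)) * (2 * CΦ ^ 2)) with hM₂
    set M₃ : ℝ := 4 * S ^ 2 * D * (T ^ (2 * B) / X₂ ^ (2 * B - 3)) with hM₃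
    set κ : ℝ := c * ε + c * Real.log (2 * π) / Real.log T with hκ
    have hM₂0 : 0 ≤ M₂ := by positivity
    have hM₃0 : 0 ≤ M₃ := by positivity
    have hκ0 : 0 ≤ κ := by positivity
    set F : ℝ → ℝ := fun t ↦ κ * g t + (Set.Icc (-X₁) X₁).indicator (fun _ ↦ M₂) t +
      M₃ * (1 + t ^ 2)⁻¹ with hF
    have hptw : ∀ t, ‖gapWidth c T / (2 * π) * (g t * ψ t)‖ ≤ F t := by
      intro t
      rw [Real.norm_eq_abs, abs_mul, abs_mul, abs_of_pos (by positivity : 0 < gapWidth c T / (2 * π)),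
        abs_of_nonneg (hg0 t), hh2π]
      have hF1 : 0 ≤ κ * g t := mul_nonneg hκ0 (hg0 t)
      have hF2 : 0 ≤ (Set.Icc (-X₁) X₁).indicator (fun _ ↦ M₂) t :=
        Set.indicator_nonneg (fun _ _ ↦ hM₂0) t
      have hF3 : 0 ≤ M₃ * (1 + t ^ 2)⁻¹ := by positivity
      show c / Real.log T * (g t * |ψ t|) ≤
        κ * g t + (Set.Icc (-X₁) X₁).indicator (fun _ ↦ M₂) t + M₃ * (1 + t ^ 2)⁻¹
      rcases le_or_gt |t| X₁ with ht1 | ht1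
      · -- inner range `|t| ≤ T^{1−ε}`
        have hψb : |ψ t| ≤ 2 * Real.log T := by
          by_cases h4 : 4 ≤ |t|
          · have hψt : ψ t = Real.log (|t| / 2) - Real.log π - Real.log T := by
              simp only [hψ, hind_of_ge t h4]
            have hlo : 0 ≤ Real.log (|t| / 2) := Real.log_nonneg (by linarith)
            have hhi : Real.log (|t| / 2) ≤ Real.log T :=
              Real.log_le_log (by linarith) (by linarith)
            rw [hψt, abs_le]; constructor <;> linarith
          · have hψt : ψ t = -Real.log π - Real.log T := by
              simp only [hψ, hind_of_lt t (not_le.mp h4)]; ring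
            rw [hψt, abs_le]; constructor <;> linarith
        have hgb : g t ≤ S ^ 2 * (2 ^ B * T ^ (-(2 * ε * B)) * (2 * CΦ ^ 2)) :=
          mul_le_mul (hRS t) (weight_le_inner w B hT1 hε1 hCΦ ht1) (weight_nonneg w B T t)
            (by positivity)
        rw [Set.indicator_of_mem (Set.mem_Icc.mpr (abs_le.mp ht1))]
        calc c / Real.log T * (g t * |ψ t|)
            ≤ c / Real.log T * (S ^ 2 * (2 ^ B * T ^ (-(2 * ε * B)) * (2 * CΦ ^ 2)) *
                (2 * Real.log T)) :=
              mul_le_mul_of_nonneg_left (mul_le_mul hgb hψb (abs_nonneg _) (by positivity))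
                hclog0.le
          _ = M₂ := by rw [hM₂]; field_simp
          _ ≤ _ := by linarith only [hF1, hF3]
      · rcases lt_or_ge |t| X₂ with ht2 | ht2
        · -- main range `T^{1−ε} < |t| < T^{1+ε}`
          have h4 : 4 ≤ |t| := by linarith
          have hψ_eq : ψ t = Real.log |t| - Real.log T - Real.log (2 * π) := by
            simp only [hψ, hind_of_ge t h4]
            rw [Real.log_div (by linarith) two_ne_zero, Real.log_mul two_ne_zero Real.pi_pos.ne']
            ring
          have hlt_lo : (1 - ε) * Real.log T < Real.log |t| := by
            rw [← hlogX₁]; exact Real.log_lt_log (by linarith) ht1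
          have hlt_hi : Real.log |t| < (1 + ε) * Real.log T := by
            rw [← hlogX₂]; exact Real.log_lt_log (by linarith) ht2
          have hψb : |ψ t| ≤ ε * Real.log T + Real.log (2 * π) := by
            rw [hψ_eq, abs_le]; constructor <;> linarith
          calc c / Real.log T * (g t * |ψ t|)
              ≤ c / Real.log T * (g t * (ε * Real.log T + Real.log (2 * π))) :=
                mul_le_mul_of_nonneg_left (mul_le_mul_of_nonneg_left hψb (hg0 t)) hclog0.le
            _ = κ * g t := by rw [hκ]; field_simp
            _ ≤ _ := by linarith only [hF2, hF3]
        · -- tail `|t| ≥ T^{1+ε} ≥ 2T`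
          have h2T : 2 * T ≤ |t| := hX₂T.trans ht2
          have h4 : 4 ≤ |t| := by linarith
          have hgb : g t ≤ S ^ 2 * (D * (T / |t|) ^ (2 * B)) :=
            mul_le_mul (hRS t) (hD T t hT1 h2T) (weight_nonneg w B T t) (by positivity)
          have hψb : |ψ t| ≤ 2 * |t| := by
            have hψt : ψ t = Real.log (|t| / 2) - Real.log π - Real.log T := by
              simp only [hψ, hind_of_ge t h4]
            have h1 : Real.log (|t| / 2) ≤ |t| / 2 - 1 := Real.log_le_sub_one_of_pos (by linarith)
            have h1' : 0 ≤ Real.log (|t| / 2) := Real.log_nonneg (by linarith)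
            have h2 : Real.log T ≤ T - 1 := Real.log_le_sub_one_of_pos hT0
            have h3 : Real.log π ≤ π - 1 := Real.log_le_sub_one_of_pos Real.pi_pos
            rw [hψt, abs_le]; constructor <;> linarith [Real.pi_le_four]
          have htail := tail_majorant hB2 hX₂1 ht2 hT0.le
          calc c / Real.log T * (g t * |ψ t|)
              ≤ 1 * (S ^ 2 * (D * (T / |t|) ^ (2 * B)) * (2 * |t|)) :=
                mul_le_mul hclog (mul_le_mul hgb hψb (abs_nonneg _) (by positivity))
                  (mul_nonneg (hg0 t) (abs_nonneg _)) zero_le_one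
            _ = 2 * S ^ 2 * D * (|t| * (T / |t|) ^ (2 * B)) := by ring
            _ ≤ 2 * S ^ 2 * D * (T ^ (2 * B) / X₂ ^ (2 * B - 3) * (2 * (1 + t ^ 2)⁻¹)) :=
                mul_le_mul_of_nonneg_left htail (by positivity)
            _ = M₃ * (1 + t ^ 2)⁻¹ := by rw [hM₃]; ring
            _ ≤ _ := by linarith only [hF1, hF2]
    -- integrate the majorant
    have hF1i : Integrable fun t ↦ κ * g t := hgi.const_mul κ
    have hF2i : Integrable fun t ↦ (Set.Icc (-X₁) X₁).indicator (fun _ ↦ M₂) t :=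
      (continuous_const.integrableOn_Icc (a := -X₁) (b := X₁)).integrable_indicator measurableSet_Icc
    have hF3i : Integrable fun t : ℝ ↦ M₃ * (1 + t ^ 2)⁻¹ := integrable_inv_one_add_sq.const_mul M₃
    have hF12i : Integrable fun t ↦ κ * g t + (Set.Icc (-X₁) X₁).indicator (fun _ ↦ M₂) t :=
      hF1i.add hF2i
    have hFi : Integrable F := hF12i.add hF3i
    have hFint : ∫ t, F t = κ * I0R w B r L T + M₂ * (2 * X₁) + M₃ * π := by
      simp only [hF]
      rw [integral_add hF12i hF3i, integral_add hF1i hF2i, integral_const_mul,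
        integral_const_mul, integral_indicator_const _ measurableSet_Icc, integral_univ_inv_one_add_sq,
        ← hI0_def, Real.volume_real_Icc_of_le (by linarith), smul_eq_mul]
      ring
    -- the numerical budget
    have hκI : κ * I0R w B r L T ≤ c * ε * I0R w B r L T + η / 2 * I0R w B r L T := by
      rw [← add_mul]
      refine mul_le_mul_of_nonneg_right ?_ hI0
      have hlogTη : 2 * c * (Real.log (2 * π) + C₃ + 1) / η ≤ Real.log T := by
        rw [Real.le_log_iff_exp_le hT0]; exact hTη
      rw [div_le_iff₀ hη] at hlogTη
      have h2 : c * Real.log (2 * π) / Real.log T ≤ η / 2 := by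
        rw [div_le_iff₀ hlogT0]
        have h3 : 0 ≤ c * (C₃ + 1) := by positivity
        nlinarith only [h3, hlogTη, hC₃, hlog2π0, hc, hη]
      rw [hκ]; linarith only [h2]
    have h2B3 : ((2 * B - 3 : ℕ) : ℝ) = 2 * B - 3 := by
      rw [Nat.cast_sub (by omega)]; push_cast; ring
    have hM₂X : M₂ * (2 * X₁) ≤ 8 * c * 2 ^ B * CΦ ^ 2 * A ^ 2 * T ^ (-C) := by
      have hexp : 2 * CL * (1 + ε) + (-(2 * ε * B) + (1 - ε)) ≤ -C := by
        have hCLε : 0 < CL * ε := mul_pos hCL hε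
        linarith only [hεB, hCLε, hCL, hε]
      calc M₂ * (2 * X₁) = 8 * c * 2 ^ B * CΦ ^ 2 * S ^ 2 * (T ^ (-(2 * ε * B)) * T ^ (1 - ε)) := by
            rw [hM₂]; ring
        _ ≤ 8 * c * 2 ^ B * CΦ ^ 2 * (A ^ 2 * T ^ (2 * CL * (1 + ε))) *
              (T ^ (-(2 * ε * B)) * T ^ (1 - ε)) := by
            gcongr
        _ = 8 * c * 2 ^ B * CΦ ^ 2 * A ^ 2 * T ^ (2 * CL * (1 + ε) + (-(2 * ε * B) + (1 - ε))) := by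
            rw [Real.rpow_add hT0, Real.rpow_add hT0]; ring
        _ ≤ 8 * c * 2 ^ B * CΦ ^ 2 * A ^ 2 * T ^ (-C) :=
            mul_le_mul_of_nonneg_left (hTpow _ _ hexp) (by positivity)
    have hM₃π : M₃ * π ≤ 4 * π * D * A ^ 2 * T ^ (-C) := by
      have hpow : T ^ (2 * B) / X₂ ^ (2 * B - 3) = T ^ (((2 * B : ℕ) : ℝ) - (1 + ε) * (2 * B - 3)) := by
        rw [hX₂, ← Real.rpow_natCast T (2 * B), ← Real.rpow_natCast (T ^ (1 + ε)) (2 * B - 3),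
          ← Real.rpow_mul hT0.le, h2B3, Real.rpow_sub hT0]
      have hexp : 2 * CL * (1 + ε) + (((2 * B : ℕ) : ℝ) - (1 + ε) * (2 * B - 3)) ≤ -C := by
        push_cast
        have hCLε : 0 < CL * ε := mul_pos hCL hε
        linarith only [hεB, hCLε, hCL, hε, hε1]
      calc M₃ * π = 4 * π * D * S ^ 2 * (T ^ (2 * B) / X₂ ^ (2 * B - 3)) := by rw [hM₃]; ring
        _ ≤ 4 * π * D * (A ^ 2 * T ^ (2 * CL * (1 + ε))) * (T ^ (2 * B) / X₂ ^ (2 * B - 3)) := by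
            gcongr
        _ = 4 * π * D * A ^ 2 * T ^ (2 * CL * (1 + ε) + (((2 * B : ℕ) : ℝ) - (1 + ε) * (2 * B - 3))) := by
            rw [hpow, Real.rpow_add hT0]; ring
        _ ≤ 4 * π * D * A ^ 2 * T ^ (-C) := mul_le_mul_of_nonneg_left (hTpow _ _ hexp) (by positivity)
    have hKhalf : 8 * c * 2 ^ B * CΦ ^ 2 * A ^ 2 * T ^ (-C) + 4 * π * D * A ^ 2 * T ^ (-C) ≤
        K / 2 * T ^ (-C) := by
      have h3 : 0 ≤ Real.exp (2 * π * w.σ) * Φ₁ ^ 2 * A ^ 2 * T ^ (-C) := by positivity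
      rw [hK]; linarith only [h3]
    -- conclusion
    rw [hset, hexpr]
    calc |∫ t, gapWidth c T / (2 * π) * (g t * ψ t)|
        = ‖∫ t, gapWidth c T / (2 * π) * (g t * ψ t)‖ := (Real.norm_eq_abs _).symm
      _ ≤ ∫ t, ‖gapWidth c T / (2 * π) * (g t * ψ t)‖ := norm_integral_le_integral_norm _
      _ ≤ ∫ t, F t := integral_mono_of_nonneg (ae_of_all _ fun t ↦ norm_nonneg _) hFi (ae_of_all _ hptw)
      _ = κ * I0R w B r L T + M₂ * (2 * X₁) + M₃ * π := hFint
      _ ≤ c * ε * I0R w B r L T + η / 2 * I0R w B r L T + K / 2 * T ^ (-C) := by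
          linarith only [hκI, hM₂X, hM₃π, hKhalf]



open Literature.Analysis.SpecialFunctions in
/-- **Proposition 1 for a window constant `c ≥ 1`, from its sides** (the same assembly as
`proposition1_of_sides`, with `archimedean_bookkeeping_of_one_le`; error `cε I₀`). Assume, for all parameters with `T ≥ 1`,
`0 < h = gapWidth c T ≤ 1`, `L ≥ 1`, `B ≥ 2`: (zero side) `I₁ = Σ_ρ m(ρ) B_{T,h}(γ_ρ)`;
(prime side) `Σ_n Λ(n)n^{−1/2}(1/2π)(B̂(log n/2π) + B̂(−log n/2π)) = (2/π)·primeSum`;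
(`ξ = 0`) `B̂(0) = h I₀`; and (Archimedean side) `|(1/2π)∫ B_{T,h} Re ψ(¼+iu/2) du −
(h/2π)∫_{|t|≥4}|R|²W_T log(|t|/2)| ≤ (C/2π) h I₀`. Then Proposition 1 holds: the explicit formula
`explicit_formula_BC`, the polar bound `norm_BC_polar_le` and `archimedean_bookkeeping_of_one_le`.
[cite: BondarenkoHeap2026, §2.2 Proposition 1 p. 6–7 ("for c > 1 the O₁(εI₀) reads O₁(cεI₀)")] -/
theorem proposition1_of_sides_of_one_le
    (hZ : ∀ (c : ℝ) (w : Bump) (B : ℕ) (r : ℕ → ℝ) (L T : ℝ), 1 ≤ T → 0 < gapWidth c T →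
      gapWidth c T ≤ 1 → 1 ≤ L → 2 ≤ B →
      (I1R c w B r L T : ℂ) = ∑' ρ : ZetaZeros.riemannZetaNontrivialZeros,
        (riemannZetaZeroOrder (ρ : ℂ) : ℂ) * BC c w B r L T (((ρ : ℂ).im : ℝ) : ℂ))
    (hP : ∀ (c : ℝ) (w : Bump) (B : ℕ) (r : ℕ → ℝ) (L T : ℝ), 1 ≤ T → 0 < gapWidth c T →
      gapWidth c T ≤ 1 → 1 ≤ L → 2 ≤ B →
      ∑' n : ℕ, ((ArithmeticFunction.vonMangoldt n : ℝ) : ℂ) / (Real.sqrt n : ℂ) *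
          ((1 / (2 * π) : ℂ) * (𝓕 (fun x : ℝ ↦ BC c w B r L T x) (Real.log n / (2 * π))
            + 𝓕 (fun x : ℝ ↦ BC c w B r L T x) (-(Real.log n / (2 * π))))) =
        ((2 / π * primeSum c w B r L T : ℝ) : ℂ))
    (h0 : ∀ (c : ℝ) (w : Bump) (B : ℕ) (r : ℕ → ℝ) (L T : ℝ), 1 ≤ T → 0 < gapWidth c T →
      gapWidth c T ≤ 1 → 1 ≤ L → 2 ≤ B →
      𝓕 (fun x : ℝ ↦ BC c w B r L T x) 0 = ((gapWidth c T * I0R w B r L T : ℝ) : ℂ))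
    (hM3 : ∃ C : ℝ, 0 ≤ C ∧ ∀ (c : ℝ) (w : Bump) (B : ℕ) (r : ℕ → ℝ) (L T : ℝ), 0 < T →
      0 < gapWidth c T → gapWidth c T ≤ 1 →
      |1 / (2 * π) * (∫ u, bWindow c w B r L T u * reDigammaQuarter u) -
          gapWidth c T / (2 * π) * ∫ t in {t : ℝ | 4 ≤ |t|},
            ‖dirichletPoly r L t‖ ^ 2 * weight w B T t * Real.log (|t| / 2)| ≤
        C / (2 * π) * gapWidth c T * I0R w B r L T) :
    RiemannHypothesis →
    ∀ (c ε C CL A : ℝ), 1 ≤ c → 0 < ε → ε < 1 → 0 < C → 0 < CL → 0 ≤ A →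
    ∀ (w : Bump), ∃ B₀ : ℕ, ∀ B : ℕ, B₀ ≤ B → ∃ K : ℝ, ∀ η : ℝ, 0 < η → ∃ T₀ : ℝ, ∀ T : ℝ, T₀ ≤ T →
    ∀ (L : ℝ), 1 ≤ L → L ≤ T ^ CL → ∀ (r : ℕ → ℝ), (∀ n : ℕ, 1 ≤ n → |r n| ≤ A * (n : ℝ) ^ ε) →
      |I1R c w B r L T - (c * I0R w B r L T - 2 / π * primeSum c w B r L T)|
        ≤ c * ε * I0R w B r L T + η * I0R w B r L T + K * T ^ (-C) := by
  intro hRH c ε C CL A hc1 hε hε1 _hC hCL hA w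
  obtain ⟨C₃, hC₃0, hM3'⟩ := hM3
  obtain ⟨B₀, hB₀⟩ := archimedean_bookkeeping_of_one_le C hc1 hε hε1 hCL hA w hC₃0
  refine ⟨B₀, fun B hB ↦ ?_⟩
  obtain ⟨K, -, hK⟩ := hB₀ B hB
  refine ⟨K, fun η hη ↦ ?_⟩
  obtain ⟨T₀, hT₀⟩ := hK η hη
  refine ⟨T₀, fun T hT L hL hLT r hr ↦ ?_⟩
  obtain ⟨hT1, hh0, hh1, hB2, hpolar, harch, hmain⟩ := hT₀ T hT L hL hLT r hr
  have hT0 : 0 < T := by linarith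
  set h : ℝ := gapWidth c T with hh
  set PS : ℝ := primeSum c w B r L T
  set I0 : ℝ := I0R w B r L T
  set X : ℝ := ∫ u, bWindow c w B r L T u * reDigammaQuarter u with hX
  set Main : ℝ := ∫ t in {t : ℝ | 4 ≤ |t|}, ‖dirichletPoly r L t‖ ^ 2 * weight w B T t *
    Real.log (|t| / 2) with hMain
  -- the explicit formula for `B_{T,h}` with both sides identified
  have hEF := (explicit_formula_BC hRH c w B r hL hT1 hB2 hh0 hh1).2
  rw [← hZ c w B r L T hT1 hh0 hh1 hL hB2, hP c w B r L T hT1 hh0 hh1 hL hB2,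
    h0 c w B r L T hT1 hh0 hh1 hL hB2] at hEF
  have hdig : ∫ u : ℝ, BC c w B r L T u * (reDigammaQuarter u : ℂ) = (X : ℂ) := by
    rw [hX, ← integral_complex_ofReal]
    congr 1
    funext u
    rw [BC_ofReal hh0.le, bWindow, integral_Icc_eq_integral_Ioo]
    push_cast
    ring
  rw [hdig] at hEF
  -- the polar terms
  set P : ℂ := BC c w B r L T (I / 2) + BC c w B r L T (-(I / 2)) with hPdef
  set rest : ℝ := -(2 / π * PS) + (1 / (2 * π) * X - 1 / (2 * π) * (h * I0) * Real.log π) with hrest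
  have hdiff : ((I1R c w B r L T - rest : ℝ) : ℂ) = P := by
    rw [hrest, hPdef]
    push_cast
    rw [hEF]
    push_cast
    ring
  have hpol : |I1R c w B r L T - rest| ≤ K / 2 * T ^ (-C) := by
    rw [← Real.norm_eq_abs, ← Complex.norm_real, hdiff, hPdef]
    have h1 := norm_BC_polar_le c w B r hL hT1 hh0.le hh1 (z₀ := I / 2) (by simp) (by simp)
    have h2 := norm_BC_polar_le c w B r hL hT1 hh0.le hh1 (z₀ := -(I / 2)) (by simp) (by simp)
    refine (norm_add_le _ _).trans ?_
    linarith
  -- the Archimedean side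
  have hA3 := hM3' c w B r L T hT0 hh0 hh1
  -- assemble
  have hsplit : I1R c w B r L T - (c * I0 - 2 / π * PS) =
      (I1R c w B r L T - rest) + (1 / (2 * π) * X - h / (2 * π) * Main) +
        (h / (2 * π) * Main - h * Real.log π / (2 * π) * I0 - c * I0) := by
    rw [hrest]; ring
  rw [hsplit]
  refine (abs_add_le _ _).trans ((add_le_add (abs_add_le _ _) le_rfl).trans ?_)
  linarith


end Prop1

/-- **Proposition 1 holds for every window constant `c ≥ 1`** [BondarenkoHeap2026, §2.2 Prop. 1,
p. 7, with the docstring remark of `proposition1`: "for `c > 1` the printed `O₁(ε I₀)` reads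
`O₁(cε I₀)`"]: on RH, `|I₁ − (cI₀ − (2/π)S)| ≤ cε I₀ + η I₀ + K T^{−C}` in the quantified form of
`proposition1` (sides (M2), (M3) plugged in by name, as in `proposition1_holds`). Used by the
LARGE-gap half of the Montgomery–Odlyzko criterion (`c` near `2`). NOT RH-BEARING: RH is the
antecedent. [cite: BondarenkoHeap2026, §2.2 Proposition 1] -/
theorem proposition1_of_one_le :
    RiemannHypothesis →
    ∀ (c ε C CL A : ℝ), 1 ≤ c → 0 < ε → ε < 1 → 0 < C → 0 < CL → 0 ≤ A →
    ∀ (w : Bump), ∃ B₀ : ℕ, ∀ B : ℕ, B₀ ≤ B → ∃ K : ℝ, ∀ η : ℝ, 0 < η → ∃ T₀ : ℝ, ∀ T : ℝ, T₀ ≤ T →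
    ∀ (L : ℝ), 1 ≤ L → L ≤ T ^ CL → ∀ (r : ℕ → ℝ), (∀ n : ℕ, 1 ≤ n → |r n| ≤ A * (n : ℝ) ^ ε) →
      |I1R c w B r L T - (c * I0R w B r L T - 2 / π * primeSum c w B r L T)|
        ≤ c * ε * I0R w B r L T + η * I0R w B r L T + K * T ^ (-C) :=
  Prop1.proposition1_of_sides_of_one_le
    (fun c w B r L T hT hh0 hh1 _ _ ↦
      (Prop1.tsum_zeroSide_BC_eq c w B r L (by linarith) hh0.le (by linarith)).symm)
    (fun c w B r L T hT hh0 _ _ _ ↦ Prop1.primeSide_BC_eq_primeSum (by linarith) hh0 w B r L)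
    (fun c w B r L T hT hh0 _ _ _ ↦ Prop1.fourier_BC_zero_eq_gapWidth_mul_I0R (by linarith) hh0 w B r L)
    Arch.exists_abs_archimedean_bWindow_sub_le

end BondarenkoHeap2026

end Literature.NumberTheory.LFunctions
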